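import Summits.MatrixMultiplication.MatrixMultiplication.Theorems.FarEdgeDescentGenericDomination
import Literature.Computability.AlgebraicComplexity.AsymptoticRankMatMul
import Literature.Computability.AlgebraicComplexity.FlatteningBound
import HarnessLib

/-!
# Every line through `⟨n,n,n⟩` bounds `ω` by its generic member; below `ω` the sublevel sets on a line are finite

Route `FarEdgeDescent` (cell `decomp-mm`, lens 2 «structural dichotomy (special vs generic)»,
gen 34), Kernel IX-d; support for the aside `SubLogRate` (stmt-MatrixMultiplication-25371).

Kernel IX-b (`FarEdgeDescentGenericDomination`) proved, from the tree's CHNVZ Theorem 1.2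
(Zariski-closedness of `{R̃ ≤ r}`), that on every affine line of tensors the sublevel sets of `R̃` are
finite or everything, that a dominant (generic) parameter exists over uncountable fields, and read this
on the BCZ line `q ↦ 𝔖(q)` through `⟨2,2,2⟩ = 𝔖(1)`.  This file states the principle for the special
point ITSELF, in every size: the lines `q ↦ ⟨n,n,n⟩ + q • D` through the matrix multiplication
tensor, `D` any tensor of its format.

* `rpow_omega_le_generic` — **`n^ω = R̃(⟨n,n,n⟩) ≤ R̃(⟨n,n,n⟩ + q₀ • D)` for every dominant `q₀`**:
  the special point is dominated by the generic member of EVERY line through it; hence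
  `omega_le_logb_generic : ω ≤ log_n R̃(⟨n,n,n⟩ + q₀ • D)` and
  `omega_le_of_generic_le : R̃(⟨n,n,n⟩ + q₀ • D) ≤ n^τ ⟹ ω ≤ τ` — upper bounds on `ω` may be read off
  the GENERIC member of any pencil through `⟨n,n,n⟩`, with the identity exponent map;
* `omega_le_of_infinite_sublevel` — **if infinitely many members of a line through `⟨n,n,n⟩` have
  `R̃ ≤ n^τ`, then `ω ≤ τ`**; contrapositively `finite_sublevel_of_lt_omega`: **for `τ < ω` every line
  through `⟨n,n,n⟩` carries only FINITELY many tensors of asymptotic rank `≤ n^τ`** — `ω` is never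
  approached from below along a line except at finitely many points;
* over `ℂ` (`exists_generic_exponent`): every direction `D` has a dominant modulus and a generic
  exponent `log_n r_gen(D) ≥ ω`; at the summit level `n = 2`, `τ = 2`:
  `summit_of_infinite_flat_line : {q | R̃(⟨2,2,2⟩ + q • D) ≤ 4}` infinite `⟹ ω = 2`, and
  `finite_flat_line_of_not_summit : ω > 2 ⟹` on every line through `⟨2,2,2⟩` the flat tensors
  (`R̃ ≤ 4`) are finitely many.

Lens reading («special vs generic»): the summit point `⟨n,n,n⟩` is special on every pencil through it
and is DOMINATED by the pencil's generic member; `ω = 2` is equivalent to flatness (`R̃ ≤ 4`) being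
GENERIC (cofinite) on one — equivalently every — line through `⟨2,2,2⟩` that contains infinitely many
flat tensors.  What is not formalised (and open): whether some line through `⟨2,2,2⟩` other than the
trivial pencil `q ↦ (1 + q) ⟨2,2,2⟩` has generic value exactly `2^ω`.

References: M. Christandl, K. Hoeberechts, H. Nieuwboer, P. Vrana, J. Zuiddam, *Asymptotic tensor
rank is characterized by polynomials* (2024/25), Thm. 1.2, Cor. 4.4, §5 [ChristandlHoeberechtsNieuwboerVranaZuiddam2025];
J. Alman, R. Duan, V. Vassilevska Williams, Y. Xu, Z. Xu, R. Zhou, SODA 2025, §3.4 (`R̃(⟨q,q,q⟩) = q^ω`)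
[AlmanDuanVassilevskaWilliamsXuXuZhou2025]; M. Bläser, *Fast Matrix Multiplication* (2013), §5
[Blaser2013].
-/

noncomputable section

open scoped BigOperators

set_option linter.dupNamespace false

namespace Summit.MatrixMultiplication.MatrixMultiplication.Theorems.FarEdgeDescentGenericLines

open Literature.Computability.AlgebraicComplexity
open Summit.MatrixMultiplication.MatrixMultiplication.Theorems.FarEdgeDescentGenericDomination

/-! ## 1. Any field: the generic member of a line through `⟨n,n,n⟩` dominates `n^ω` -/

section AnyField

variable {K : Type} [Field K] {n : ℕ}

/-- The base point of the pencil: the member at `q = 0` is `⟨n,n,n⟩` itself. [folklore] -/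
theorem line_zero (D : Fin n × Fin n → Fin n × Fin n → Fin n × Fin n → K) :
    matMulTensor K n n n + (0 : K) • D = matMulTensor K n n n := by
  rw [zero_smul, add_zero]

/-- **`n^ω ≤ R̃(⟨n,n,n⟩ + q₀ • D)` for every dominant `q₀`**: the special point `⟨n,n,n⟩` (`q = 0`,
`R̃ = n^ω`) is dominated by the generic member of every line through it. [cite: ChristandlHoeberechtsNieuwboerVranaZuiddam2025, Theorem 1.2] -/
theorem rpow_omega_le_generic {D : Fin n × Fin n → Fin n × Fin n → Fin n × Fin n → K} {q₀ : K}
    (hq₀ : ∀ q : K, asymptoticRank (matMulTensor K n n n + q • D) ≤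
      asymptoticRank (matMulTensor K n n n + q₀ • D)) :
    (n : ℝ) ^ omega K ≤ asymptoticRank (matMulTensor K n n n + q₀ • D) := by
  have h0 := hq₀ 0
  rw [line_zero] at h0
  exact (rpow_omega_le_asymptoticRank_matMulTensor K n).trans h0

/-- **`R̃(⟨n,n,n⟩ + q₀ • D) ≤ n^τ ⟹ ω ≤ τ`** (`n ≥ 2`, `q₀` dominant): upper bounds on `ω` from the
GENERIC member of a pencil, with the identity exponent map. [cite: ChristandlHoeberechtsNieuwboerVranaZuiddam2025, Theorem 1.2] -/
theorem omega_le_of_generic_le (hn : 2 ≤ n)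
    {D : Fin n × Fin n → Fin n × Fin n → Fin n × Fin n → K} {q₀ : K}
    (hq₀ : ∀ q : K, asymptoticRank (matMulTensor K n n n + q • D) ≤
      asymptoticRank (matMulTensor K n n n + q₀ • D))
    {τ : ℝ} (h : asymptoticRank (matMulTensor K n n n + q₀ • D) ≤ (n : ℝ) ^ τ) : omega K ≤ τ := by
  have hn1 : (1 : ℝ) < n := by exact_mod_cast hn
  exact (Real.rpow_le_rpow_left_iff hn1).1 ((rpow_omega_le_generic hq₀).trans h)

/-- **`ω ≤ log_n R̃(⟨n,n,n⟩ + q₀ • D)`**: the generic exponent of every pencil through `⟨n,n,n⟩`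
bounds `ω`. [cite: ChristandlHoeberechtsNieuwboerVranaZuiddam2025, Theorem 1.2] -/
theorem omega_le_logb_generic (hn : 2 ≤ n)
    {D : Fin n × Fin n → Fin n × Fin n → Fin n × Fin n → K} {q₀ : K}
    (hq₀ : ∀ q : K, asymptoticRank (matMulTensor K n n n + q • D) ≤
      asymptoticRank (matMulTensor K n n n + q₀ • D)) :
    omega K ≤ Real.logb n (asymptoticRank (matMulTensor K n n n + q₀ • D)) := by
  have hn1 : (1 : ℝ) < n := by exact_mod_cast hn
  have hpos : 0 < asymptoticRank (matMulTensor K n n n + q₀ • D) :=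
    lt_of_lt_of_le (Real.rpow_pos_of_pos (by linarith) _) (rpow_omega_le_generic hq₀)
  exact (Real.le_logb_iff_rpow_le hn1 hpos).2 (rpow_omega_le_generic hq₀)

/-- **Infinitely many members with `R̃ ≤ n^τ` force `ω ≤ τ`**: by the sublevel dichotomy the whole
line, in particular `q = 0`, then lies in the sublevel set. [cite: ChristandlHoeberechtsNieuwboerVranaZuiddam2025, Theorem 1.2] -/
theorem omega_le_of_infinite_sublevel (hn : 2 ≤ n)
    {D : Fin n × Fin n → Fin n × Fin n → Fin n × Fin n → K} {τ : ℝ}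
    (h : {q : K | asymptoticRank (matMulTensor K n n n + q • D) ≤ (n : ℝ) ^ τ}.Infinite) :
    omega K ≤ τ := by
  have hn1 : (1 : ℝ) < n := by exact_mod_cast hn
  have huniv := (sublevel_eq_univ_or_finite (matMulTensor K n n n) D ((n : ℝ) ^ τ)).resolve_right h
  have h0 : asymptoticRank (matMulTensor K n n n + (0 : K) • D) ≤ (n : ℝ) ^ τ :=
    show (0 : K) ∈ {q : K | asymptoticRank (matMulTensor K n n n + q • D) ≤ (n : ℝ) ^ τ} from
      huniv ▸ Set.mem_univ _
  rw [line_zero] at h0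
  exact (Real.rpow_le_rpow_left_iff hn1).1 ((rpow_omega_le_asymptoticRank_matMulTensor K n).trans h0)

/-- **Below `ω` the sublevel sets on a line are finite**: for `τ < ω`, every line through `⟨n,n,n⟩`
carries only finitely many tensors of asymptotic rank `≤ n^τ` — `ω` is not approached from below
along a line except at finitely many points. [cite: ChristandlHoeberechtsNieuwboerVranaZuiddam2025, Theorem 1.2] -/
theorem finite_sublevel_of_lt_omega (hn : 2 ≤ n)
    (D : Fin n × Fin n → Fin n × Fin n → Fin n × Fin n → K) {τ : ℝ} (hτ : τ < omega K) :
    {q : K | asymptoticRank (matMulTensor K n n n + q • D) ≤ (n : ℝ) ^ τ}.Finite :=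
  Set.not_infinite.1 fun h => not_le.2 hτ (omega_le_of_infinite_sublevel hn h)

/-- The generic value of a pencil is at least `n^ω > 0`, so every dominant member is nonzero in `R̃`.
[cite: ChristandlHoeberechtsNieuwboerVranaZuiddam2025, Theorem 1.2] -/
theorem generic_pos (hn : 1 ≤ n) {D : Fin n × Fin n → Fin n × Fin n → Fin n × Fin n → K} {q₀ : K}
    (hq₀ : ∀ q : K, asymptoticRank (matMulTensor K n n n + q • D) ≤
      asymptoticRank (matMulTensor K n n n + q₀ • D)) :
    0 < asymptoticRank (matMulTensor K n n n + q₀ • D) :=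
  lt_of_lt_of_le (Real.rpow_pos_of_pos (by exact_mod_cast hn) _) (rpow_omega_le_generic hq₀)

end AnyField

/-! ## 2. Over `ℂ`: generic exponents exist; the summit level -/

section Complex

variable {n : ℕ}

/-- **Every pencil through `⟨n,n,n⟩` over `ℂ` has a dominant modulus, and its generic exponent bounds
`ω`**: `∃ q₀, (∀ q, R̃(⟨n,n,n⟩ + q D) ≤ R̃(⟨n,n,n⟩ + q₀ D)) ∧ ω ≤ log_n R̃(⟨n,n,n⟩ + q₀ D)`.
[cite: ChristandlHoeberechtsNieuwboerVranaZuiddam2025, Corollary 4.4] -/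
theorem exists_generic_exponent (hn : 2 ≤ n)
    (D : Fin n × Fin n → Fin n × Fin n → Fin n × Fin n → ℂ) :
    ∃ q₀ : ℂ, (∀ q : ℂ, asymptoticRank (matMulTensor ℂ n n n + q • D) ≤
        asymptoticRank (matMulTensor ℂ n n n + q₀ • D)) ∧
      omega ℂ ≤ Real.logb n (asymptoticRank (matMulTensor ℂ n n n + q₀ • D)) := by
  obtain ⟨q₀, hq₀⟩ := exists_dominant not_countable_complex (matMulTensor ℂ n n n) D
  exact ⟨q₀, hq₀, omega_le_logb_generic hn hq₀⟩

/-- `4 = 2^2` as a real power. [folklore] -/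
theorem four_eq_two_rpow_two : (4 : ℝ) = (2 : ℝ) ^ (2 : ℝ) := by
  rw [Real.rpow_two]; norm_num

/-- **Infinitely many flat tensors on a line through `⟨2,2,2⟩` force `ω = 2`**: if
`R̃(⟨2,2,2⟩ + q • D) ≤ 4` for infinitely many `q`, then `ω ≤ 2`, i.e. `ω = 2`. [cite: ChristandlHoeberechtsNieuwboerVranaZuiddam2025, Theorem 1.2] -/
theorem summit_of_infinite_flat_line {D : Fin 2 × Fin 2 → Fin 2 × Fin 2 → Fin 2 × Fin 2 → ℂ}
    (h : {q : ℂ | asymptoticRank (matMulTensor ℂ 2 2 2 + q • D) ≤ 4}.Infinite) :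
    _root_.MatrixMultiplication := by
  have h' : {q : ℂ | asymptoticRank (matMulTensor ℂ 2 2 2 + q • D) ≤ ((2 : ℕ) : ℝ) ^ (2 : ℝ)}.Infinite := by
    simpa only [Nat.cast_ofNat, ← four_eq_two_rpow_two] using h
  have hle := omega_le_of_infinite_sublevel (K := ℂ) (n := 2) le_rfl h'
  exact (_root_.MatrixMultiplication_iff).2 (le_antisymm hle (omega_two_le ℂ))

/-- **`ω > 2 ⟹` the flat tensors on every line through `⟨2,2,2⟩` are finitely many.** [cite: ChristandlHoeberechtsNieuwboerVranaZuiddam2025, Theorem 1.2] -/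
theorem finite_flat_line_of_not_summit (hS : ¬ _root_.MatrixMultiplication)
    (D : Fin 2 × Fin 2 → Fin 2 × Fin 2 → Fin 2 × Fin 2 → ℂ) :
    {q : ℂ | asymptoticRank (matMulTensor ℂ 2 2 2 + q • D) ≤ 4}.Finite :=
  Set.not_infinite.1 fun h => hS (summit_of_infinite_flat_line h)

/-- **The generic member of a flat-rich line is flat**: if a line through `⟨2,2,2⟩` contains infinitely
many flat tensors then ALL its members are flat (sublevel dichotomy). [cite: ChristandlHoeberechtsNieuwboerVranaZuiddam2025, Theorem 1.2] -/
theorem all_flat_of_infinite_flat_line {D : Fin 2 × Fin 2 → Fin 2 × Fin 2 → Fin 2 × Fin 2 → ℂ}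
    (h : {q : ℂ | asymptoticRank (matMulTensor ℂ 2 2 2 + q • D) ≤ 4}.Infinite) (q : ℂ) :
    asymptoticRank (matMulTensor ℂ 2 2 2 + q • D) ≤ 4 :=
  show q ∈ {q : ℂ | asymptoticRank (matMulTensor ℂ 2 2 2 + q • D) ≤ 4} from
    ((sublevel_eq_univ_or_finite (matMulTensor ℂ 2 2 2) D 4).resolve_right h) ▸ Set.mem_univ q

/-- **`ω > 2` on a pencil, quantitatively**: for every direction `D` and every dominant modulus `q₀`,
`¬ ω = 2 ⟹ 4 < 2^ω ≤ R̃(⟨2,2,2⟩ + q₀ • D)` — the generic member carries the full excess.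
[cite: ChristandlHoeberechtsNieuwboerVranaZuiddam2025, Theorem 1.2] -/
theorem four_lt_generic_of_not_summit (hS : ¬ _root_.MatrixMultiplication)
    {D : Fin 2 × Fin 2 → Fin 2 × Fin 2 → Fin 2 × Fin 2 → ℂ} {q₀ : ℂ}
    (hq₀ : ∀ q : ℂ, asymptoticRank (matMulTensor ℂ 2 2 2 + q • D) ≤
      asymptoticRank (matMulTensor ℂ 2 2 2 + q₀ • D)) :
    4 < asymptoticRank (matMulTensor ℂ 2 2 2 + q₀ • D) := by
  have hω : 2 < omega ℂ :=
    lt_of_le_of_ne (omega_two_le ℂ) fun h => hS ((_root_.MatrixMultiplication_iff).2 h.symm)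
  have h4 : (4 : ℝ) < (2 : ℝ) ^ omega ℂ := by
    rw [four_eq_two_rpow_two]
    exact Real.rpow_lt_rpow_of_exponent_lt one_lt_two hω
  have hgen := rpow_omega_le_generic (K := ℂ) (n := 2) hq₀
  rw [Nat.cast_ofNat] at hgen
  exact h4.trans_le hgen

end Complex

end Summit.MatrixMultiplication.MatrixMultiplication.Theorems.FarEdgeDescentGenericLines

end
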